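import Literature.MathematicalPhysics.QuantumFieldTheory.ConformalBootstrap3D.ZSeriesBlockCoefficients

/-!
# Two-sided `Δ`-cell bounds for the Hogervorst–Rychkov coefficients

The head obligations (O2)–(O4) of a certificate are CELL statements: block positivity uniformly for
`Δ` in a cell `[Δ₁, Δ₂]`. The `z`-series coefficients `A_{n,j}(Δ)` (`hrCoeff Δ ℓ n j`, recursion
(3.9) of Hogervorst–Rychkov) are rational functions of `Δ`; this file gives a rigorous `Δ`-uniform
two-sided bound on them from two endpoint evaluations, on the closed region `Δ ≥ ℓ + 1` (which is
the closed unitarity region for `ℓ ≥ 1` and the part `Δ ≥ 1` of it for `ℓ = 0`):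

* `pivotProd Δ ℓ n` — the product of the recursion pivots `C_{Δ+m,i} - C_{Δ,ℓ}` (`casimirPivot3D`)
  over the descendant range at levels `2 ≤ m ≤ n`. Every level-`m ≥ 2` pivot is `≥ m(m-1) > 0` on
  `Δ ≥ ℓ + 1` (`casimirPivot3D_pos_of_two_le`) and non-decreasing in `Δ`; the one pivot vanishing at
  the bound, `2(Δ-ℓ-1)` at `(1, ℓ-1)`, is cancelled analytically at level one:
  `A_{1,ℓ-1} = (Δ-ℓ-1)ℓ/(2(2ℓ+1))` (`hrCoeff_one_pred`, valid AT the bound too, where Lean's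
  `x/0 = 0` returns the limiting value `0`).
* `hrNum Δ ℓ n j := hrCoeff Δ ℓ n j * pivotProd Δ ℓ n` is NON-DECREASING in `Δ ≥ ℓ + 1`
  (`hrNum_mono`): level `1` by the closed forms; from level `2` on, clearing the pivots leaves sums of
  products of the squares `γ^±` (non-decreasing there — for `γ⁻_{Δ+n,j+1} = (Δ+n-j-2)²(…)` because
  `j + 1 ≤ ℓ + n` on the support and `Δ ≥ ℓ + 1`), of the level-`n` quantities, and of the other
  pivots of the level.
* Hence on a cell `ℓ + 1 ≤ Δ₁ ≤ Δ ≤ Δ₂`: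
  `A_{n,j}(Δ₁) · P_n(Δ₁)/P_n(Δ₂) ≤ A_{n,j}(Δ) ≤ A_{n,j}(Δ₂) · P_n(Δ₂)/P_n(Δ₁)`
  (`hrCoeff_cell_lower`, `hrCoeff_cell_upper`), the four outside numbers being finite rational
  evaluations when `Δ₁, Δ₂ ∈ ℚ`. Size of the slack: `P_n(Δ₂)/P_n(Δ₁) ≈ 1.19` for `ℓ = 0`,
  `[Δ₁, Δ₂] = [1.7, 1.71]`, `n = 22`, and `≈ 1.045` for width `0.0025` (floating-point evaluation).

The restriction `Δ ≥ ℓ + 1` matters only at `ℓ = 0` (bound `1/2`): on `(1/2, 1)` the coefficient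
`A_{2,0} = Δ(Δ-1)²/(24(Δ-1/2))` is decreasing. Numerically (floating point, `n ≤ 60`, `ℓ ≤ 40`,
`Δ ∈ [ℓ+1, ℓ+24]`, grid step `0.01`) the coefficients `A_{n,j}(Δ)` THEMSELVES are non-decreasing in
`Δ`; that sharper statement is not claimed here.
[cite: HogervorstRychkov2013, §3 eq. (3.9)]
-/

noncomputable section

namespace Literature.MathematicalPhysics.QuantumFieldTheory.ConformalBootstrap3D

open Finset

/-! ### Pivots on the closed region `Δ ≥ ℓ + 1` -/

/-- `unitarityBound3D ℓ ≤ ℓ + 1` (equality for `ℓ ≥ 1`, `1/2 ≤ 1` at `ℓ = 0`). [folklore] -/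
theorem unitarityBound3D_le_add_one (ℓ : ℕ) : unitarityBound3D ℓ ≤ (ℓ : ℝ) + 1 := by
  unfold unitarityBound3D
  split_ifs with h
  · subst h; norm_num
  · exact le_rfl

/-- The pivot `2nΔ + n(n-3) + j(j+1) - ℓ(ℓ+1)` is non-decreasing in `Δ`.
[cite: HogervorstRychkov2013, §3 after eq. (3.9)] -/
theorem casimirPivot3D_mono {Δ Δ' : ℝ} (h : Δ ≤ Δ') (ℓ n j : ℕ) :
    casimirPivot3D Δ ℓ n j ≤ casimirPivot3D Δ' ℓ n j := by
  unfold casimirPivot3D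
  have hn : (0 : ℝ) ≤ 2 * (n : ℝ) := by positivity
  nlinarith

/-- On the descendant range with `n ≥ 1` and `Δ ≥ ℓ + 1` the pivot is `≥ n(n-1) ≥ 0` (it may vanish
only at `n = 1`, `j = ℓ - 1`, `Δ = ℓ + 1`). [cite: HogervorstRychkov2013, §3 after eq. (3.9)] -/
theorem casimirPivot3D_ge_of_le {Δ : ℝ} {ℓ n j : ℕ} (hΔ : (ℓ : ℝ) + 1 ≤ Δ) (hn : 1 ≤ n)
    (hjl : ℓ ≤ j + n) :
    (n : ℝ) * ((n : ℝ) - 1) ≤ casimirPivot3D Δ ℓ n j := by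
  unfold casimirPivot3D
  have hn' : (1 : ℝ) ≤ (n : ℝ) := by exact_mod_cast hn
  have h2n : 2 * (n : ℝ) * ((ℓ : ℝ) + 1) ≤ 2 * (n : ℝ) * Δ :=
    mul_le_mul_of_nonneg_left hΔ (by positivity)
  rcases le_or_gt ℓ j with hle | hlt
  · -- `j ≥ ℓ`: `j(j+1) ≥ ℓ(ℓ+1)`
    have hle' : (ℓ : ℝ) ≤ (j : ℝ) := by exact_mod_cast hle
    have hjj : (ℓ : ℝ) * ((ℓ : ℝ) + 1) ≤ (j : ℝ) * ((j : ℝ) + 1) := by nlinarith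
    nlinarith
  · -- `j = ℓ - k`, `1 ≤ k ≤ n`
    obtain ⟨k, hk⟩ : ∃ k, ℓ = j + k := ⟨ℓ - j, by omega⟩
    have hkn : k ≤ n := by omega
    have hk' : (ℓ : ℝ) = (j : ℝ) + (k : ℝ) := by exact_mod_cast hk
    have hkn' : (k : ℝ) ≤ (n : ℝ) := by exact_mod_cast hkn
    have hk0 : (0 : ℝ) ≤ (k : ℝ) := by positivity
    have hj0 : (0 : ℝ) ≤ (j : ℝ) := by positivity
    rw [hk'] at h2n ⊢
    nlinarith

/-- Non-negativity of the pivots on the descendant range, `n ≥ 1`, `Δ ≥ ℓ + 1`.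
[cite: HogervorstRychkov2013, §3 after eq. (3.9)] -/
theorem casimirPivot3D_nonneg_of_le {Δ : ℝ} {ℓ n j : ℕ} (hΔ : (ℓ : ℝ) + 1 ≤ Δ) (hn : 1 ≤ n)
    (hjl : ℓ ≤ j + n) : 0 ≤ casimirPivot3D Δ ℓ n j := by
  have h := casimirPivot3D_ge_of_le hΔ hn hjl
  have hn' : (1 : ℝ) ≤ (n : ℝ) := by exact_mod_cast hn
  have : (0 : ℝ) ≤ (n : ℝ) * ((n : ℝ) - 1) := mul_nonneg (by linarith) (by linarith)
  linarith

/-- Strict positivity of the pivots at levels `n ≥ 2` on `Δ ≥ ℓ + 1` (closed!).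
[cite: HogervorstRychkov2013, §3 after eq. (3.9)] -/
theorem casimirPivot3D_pos_of_two_le {Δ : ℝ} {ℓ n j : ℕ} (hΔ : (ℓ : ℝ) + 1 ≤ Δ) (hn : 2 ≤ n)
    (hjl : ℓ ≤ j + n) : 0 < casimirPivot3D Δ ℓ n j := by
  have h := casimirPivot3D_ge_of_le hΔ (by omega) hjl
  have hn' : (2 : ℝ) ≤ (n : ℝ) := by exact_mod_cast hn
  have : (0 : ℝ) < (n : ℝ) * ((n : ℝ) - 1) := mul_pos (by linarith) (by linarith)
  linarith

/-- **Non-negativity on the closed region.** For `Δ ≥ ℓ + 1` every `A_{n,j}(Δ) ≥ 0` (at the one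
vanishing pivot Lean's `x/0 = 0` gives `A_{1,ℓ-1}(ℓ+1) = 0`, the limiting value).
[cite: HogervorstRychkov2013, §3 after eq. (3.9)] -/
theorem hrCoeff_nonneg_of_le {Δ : ℝ} {ℓ : ℕ} (hΔ : (ℓ : ℝ) + 1 ≤ Δ) :
    ∀ n j : ℕ, 0 ≤ hrCoeff Δ ℓ n j := by
  intro n
  induction n with
  | zero =>
    intro j
    by_cases h : j = ℓ
    · subst h; simp
    · rw [hrCoeff_zero_of_ne Δ h]
  | succ n ih =>
    intro j
    by_cases hr : InDescendantRange ℓ (n + 1) j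
    · obtain ⟨h1, _, _⟩ := hr
      rw [hrCoeff_succ]
      apply div_nonneg
      · apply add_nonneg
        · split_ifs
          · exact le_rfl
          · exact mul_nonneg (hrGammaPlus_nonneg _ _) (ih _)
        · exact mul_nonneg (hrGammaMinus_nonneg _ _) (ih _)
      · exact casimirPivot3D_nonneg_of_le hΔ (by omega) h1
    · rw [hrCoeff_eq_zero_of_not_inDescendantRange Δ hr]

/-- `γ⁺_{E,j}` is non-decreasing in `E ≥ 0`. [cite: HogervorstRychkov2013, §3 eq. (3.8)] -/
theorem hrGammaPlus_mono {E E' : ℝ} (hE : 0 ≤ E) (h : E ≤ E') (j : ℕ) :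
    hrGammaPlus E j ≤ hrGammaPlus E' j := by
  unfold hrGammaPlus
  have h1 : 0 ≤ E + (j : ℝ) := by positivity
  have h2 : (E + (j : ℝ)) ^ 2 ≤ (E' + (j : ℝ)) ^ 2 := pow_le_pow_left₀ h1 (by linarith) 2
  have h3 : (0 : ℝ) < 2 * (j : ℝ) + 1 := by positivity
  exact div_le_div_of_nonneg_right (mul_le_mul_of_nonneg_right h2 (by positivity)) h3.le

/-- `γ⁻_{E,j}` is non-decreasing in `E ≥ j + 1`. [cite: HogervorstRychkov2013, §3 eq. (3.8)] -/
theorem hrGammaMinus_mono {E E' : ℝ} {j : ℕ} (hE : (j : ℝ) + 1 ≤ E) (h : E ≤ E') :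
    hrGammaMinus E j ≤ hrGammaMinus E' j := by
  unfold hrGammaMinus
  have h1 : 0 ≤ E - (j : ℝ) - 1 := by linarith
  have h2 : (E - (j : ℝ) - 1) ^ 2 ≤ (E' - (j : ℝ) - 1) ^ 2 := pow_le_pow_left₀ h1 (by linarith) 2
  have h3 : (0 : ℝ) < 2 * (j : ℝ) + 1 := by positivity
  exact div_le_div_of_nonneg_right (mul_le_mul_of_nonneg_right h2 (by positivity)) h3.le

/-! ### Level one in closed form -/

/-- `A_{1,ℓ+1} = (Δ+ℓ)(ℓ+1)/(2(2ℓ+1))` on `Δ ≥ ℓ + 1` (Hogervorst–Rychkov 2013, eq. (3.10); the tree's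
`hrCoeff_one_succ` assumes the strict unitarity bound). [cite: HogervorstRychkov2013, §3 eq. (3.10)] -/
theorem hrCoeff_one_succ_of_le {Δ : ℝ} {ℓ : ℕ} (hΔ : (ℓ : ℝ) + 1 ≤ Δ) :
    hrCoeff Δ ℓ 1 (ℓ + 1) = (Δ + ℓ) * ((ℓ : ℝ) + 1) / (2 * (2 * (ℓ : ℝ) + 1)) := by
  have hℓ0 : (0 : ℝ) ≤ ℓ := Nat.cast_nonneg ℓ
  have hne : Δ + (ℓ : ℝ) ≠ 0 := by intro h; linarith
  rw [hrCoeff_succ]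
  have h0 : hrGammaMinus (Δ + ((0 : ℕ) : ℝ)) (ℓ + 1 + 1) * hrCoeff Δ ℓ 0 (ℓ + 1 + 1) = 0 := by
    rw [hrCoeff_zero_of_ne Δ (show ℓ + 1 + 1 ≠ ℓ by omega), mul_zero]
  rw [h0, add_zero, if_neg (show ℓ + 1 ≠ 0 by omega), show ℓ + 1 - 1 = ℓ by omega, hrCoeff_zero_self]
  have hp : casimirPivot3D Δ ℓ 1 (ℓ + 1) = 2 * (Δ + (ℓ : ℝ)) := by
    unfold casimirPivot3D; push_cast; ring
  rw [hp, hrGammaPlus]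
  push_cast
  field_simp
  ring

/-- `A_{1,ℓ-1} = (Δ-ℓ-1)ℓ/(2(2ℓ+1))` for `ℓ = k + 1 ≥ 1` on `Δ ≥ ℓ + 1` — including AT the bound,
where the pivot vanishes and both sides are `0` (Hogervorst–Rychkov 2013, eq. (3.10)).
[cite: HogervorstRychkov2013, §3 eq. (3.10)] -/
theorem hrCoeff_one_pred {Δ : ℝ} {k : ℕ} (hΔ : (((k + 1 : ℕ) : ℝ)) + 1 ≤ Δ) :
    hrCoeff Δ (k + 1) 1 k =
      (Δ - ((k : ℝ) + 1) - 1) * ((k : ℝ) + 1) / (2 * (2 * ((k : ℝ) + 1) + 1)) := by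
  push_cast at hΔ
  rw [hrCoeff_succ]
  have h0 : (if k = 0 then (0 : ℝ)
      else hrGammaPlus (Δ + ((0 : ℕ) : ℝ)) (k - 1) * hrCoeff Δ (k + 1) 0 (k - 1)) = 0 := by
    split_ifs with hk
    · rfl
    · rw [hrCoeff_zero_of_ne Δ (show k - 1 ≠ k + 1 by omega), mul_zero]
  rw [h0, zero_add, hrCoeff_zero_self, mul_one]
  have hp : casimirPivot3D Δ (k + 1) 1 k = 2 * (Δ - (k : ℝ) - 2) := by
    unfold casimirPivot3D; push_cast; ring
  rw [hp, hrGammaMinus]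
  push_cast
  by_cases he : Δ - (k : ℝ) - 2 = 0
  · have hΔe : Δ = (k : ℝ) + 2 := by linarith
    rw [hΔe]
    ring_nf
  · field_simp
    ring

/-- Level one is non-decreasing in `Δ ≥ ℓ + 1` (both closed forms are affine with positive slope;
other spins vanish). [cite: HogervorstRychkov2013, §3 eq. (3.10)] -/
theorem hrCoeff_one_mono {Δ Δ' : ℝ} {ℓ : ℕ} (hΔ : (ℓ : ℝ) + 1 ≤ Δ) (h : Δ ≤ Δ') (j : ℕ) :
    hrCoeff Δ ℓ 1 j ≤ hrCoeff Δ' ℓ 1 j := by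
  have hΔ2 : (ℓ : ℝ) + 1 ≤ Δ' := hΔ.trans h
  by_cases h1 : j = ℓ + 1
  · subst h1
    rw [hrCoeff_one_succ_of_le hΔ, hrCoeff_one_succ_of_le hΔ2]
    have hpos : (0 : ℝ) < 2 * (2 * (ℓ : ℝ) + 1) := by positivity
    exact div_le_div_of_nonneg_right (mul_le_mul_of_nonneg_right (by linarith) (by positivity))
      hpos.le
  · by_cases h2 : j + 1 = ℓ
    · subst h2
      have hΔc : (((j + 1 : ℕ) : ℝ)) + 1 ≤ Δ := by push_cast; exact_mod_cast hΔ
      have hΔc2 : (((j + 1 : ℕ) : ℝ)) + 1 ≤ Δ' := by push_cast; exact_mod_cast hΔ2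
      rw [hrCoeff_one_pred hΔc, hrCoeff_one_pred hΔc2]
      have hpos : (0 : ℝ) < 2 * (2 * ((j : ℝ) + 1) + 1) := by positivity
      exact div_le_div_of_nonneg_right (mul_le_mul_of_nonneg_right (by linarith) (by positivity))
        hpos.le
    · have hr : ¬ InDescendantRange ℓ 1 j := by
        unfold InDescendantRange; omega
      rw [hrCoeff_eq_zero_of_not_inDescendantRange Δ hr,
        hrCoeff_eq_zero_of_not_inDescendantRange Δ' hr]

/-! ### The level sets and the pivot products -/

/-- The descendant range at level `m` as a finite set of spins.
[cite: HogervorstRychkov2013, §3 eq. (3.5)] -/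
def descendantLevel (ℓ m : ℕ) : Finset ℕ :=
  (Finset.range (ℓ + m + 1)).filter (fun i => InDescendantRange ℓ m i)

/-- Membership. [cite: HogervorstRychkov2013, §3 eq. (3.5)] -/
theorem mem_descendantLevel {ℓ m i : ℕ} : i ∈ descendantLevel ℓ m ↔ InDescendantRange ℓ m i := by
  unfold descendantLevel
  simp only [Finset.mem_filter, Finset.mem_range]
  constructor
  · exact fun h => h.2
  · intro h
    refine ⟨?_, h⟩
    have := h.2.1
    omega

/-- The product of the pivots over the descendant range at level `m`.
[cite: HogervorstRychkov2013, §3 eq. (3.9)] -/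
def levelPivotProd (Δ : ℝ) (ℓ m : ℕ) : ℝ :=
  ∏ i ∈ descendantLevel ℓ m, casimirPivot3D Δ ℓ m i

/-- The product of all pivots at levels `2, …, n` (`= 1` for `n ≤ 1`).
[cite: HogervorstRychkov2013, §3 eq. (3.9)] -/
def pivotProd (Δ : ℝ) (ℓ n : ℕ) : ℝ :=
  ∏ m ∈ Finset.Ico 2 (n + 1), levelPivotProd Δ ℓ m

/-- [folklore] -/
theorem pivotProd_zero (Δ : ℝ) (ℓ : ℕ) : pivotProd Δ ℓ 0 = 1 := by
  simp [pivotProd]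

/-- [folklore] -/
theorem pivotProd_one (Δ : ℝ) (ℓ : ℕ) : pivotProd Δ ℓ 1 = 1 := by
  simp [pivotProd]

/-- [folklore] -/
theorem pivotProd_succ (Δ : ℝ) (ℓ : ℕ) {n : ℕ} (hn : 1 ≤ n) :
    pivotProd Δ ℓ (n + 1) = pivotProd Δ ℓ n * levelPivotProd Δ ℓ (n + 1) := by
  unfold pivotProd
  exact Finset.prod_Ico_succ_top (by omega) _

/-- Level pivot products are positive for `m ≥ 2` on `Δ ≥ ℓ + 1`.
[cite: HogervorstRychkov2013, §3 after eq. (3.9)] -/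
theorem levelPivotProd_pos {Δ : ℝ} {ℓ m : ℕ} (hΔ : (ℓ : ℝ) + 1 ≤ Δ) (hm : 2 ≤ m) :
    0 < levelPivotProd Δ ℓ m := by
  unfold levelPivotProd
  refine Finset.prod_pos fun i hi => ?_
  have hr := mem_descendantLevel.1 hi
  exact casimirPivot3D_pos_of_two_le hΔ hm hr.1

/-- … and non-decreasing in `Δ`. [cite: HogervorstRychkov2013, §3 after eq. (3.9)] -/
theorem levelPivotProd_mono {Δ Δ' : ℝ} {ℓ m : ℕ} (hΔ : (ℓ : ℝ) + 1 ≤ Δ) (hm : 2 ≤ m)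
    (h : Δ ≤ Δ') : levelPivotProd Δ ℓ m ≤ levelPivotProd Δ' ℓ m := by
  unfold levelPivotProd
  refine Finset.prod_le_prod (fun i hi => ?_) (fun i _ => casimirPivot3D_mono h ℓ m i)
  have hr := mem_descendantLevel.1 hi
  exact (casimirPivot3D_pos_of_two_le hΔ hm hr.1).le

/-- `P_n(Δ) > 0` on `Δ ≥ ℓ + 1`. [cite: HogervorstRychkov2013, §3 after eq. (3.9)] -/
theorem pivotProd_pos {Δ : ℝ} {ℓ : ℕ} (hΔ : (ℓ : ℝ) + 1 ≤ Δ) (n : ℕ) :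
    0 < pivotProd Δ ℓ n := by
  unfold pivotProd
  exact Finset.prod_pos fun m hm => levelPivotProd_pos hΔ (Finset.mem_Ico.1 hm).1

/-- `P_n` is non-decreasing in `Δ ≥ ℓ + 1`. [cite: HogervorstRychkov2013, §3 after eq. (3.9)] -/
theorem pivotProd_mono {Δ Δ' : ℝ} {ℓ : ℕ} (hΔ : (ℓ : ℝ) + 1 ≤ Δ) (h : Δ ≤ Δ') (n : ℕ) :
    pivotProd Δ ℓ n ≤ pivotProd Δ' ℓ n := by
  unfold pivotProd
  exact Finset.prod_le_prod (fun m hm => (levelPivotProd_pos hΔ (Finset.mem_Ico.1 hm).1).le)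
    (fun m hm => levelPivotProd_mono hΔ (Finset.mem_Ico.1 hm).1 h)

/-! ### The pivot-cleared coefficients `hrNum` and their monotonicity -/

/-- `Ã_{n,j}(Δ) := A_{n,j}(Δ) · P_n(Δ)`. [cite: HogervorstRychkov2013, §3 eq. (3.9)] -/
def hrNum (Δ : ℝ) (ℓ n j : ℕ) : ℝ :=
  hrCoeff Δ ℓ n j * pivotProd Δ ℓ n

/-- `Ã ≥ 0` on `Δ ≥ ℓ + 1`. [cite: HogervorstRychkov2013, §3 after eq. (3.9)] -/
theorem hrNum_nonneg {Δ : ℝ} {ℓ : ℕ} (hΔ : (ℓ : ℝ) + 1 ≤ Δ) (n j : ℕ) : 0 ≤ hrNum Δ ℓ n j :=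
  mul_nonneg (hrCoeff_nonneg_of_le hΔ n j) (pivotProd_pos hΔ n).le

/-- Off the descendant range `Ã_{n,j} = 0`. [cite: HogervorstRychkov2013, §3 eq. (3.5)] -/
theorem hrNum_eq_zero_of_not_inDescendantRange (Δ : ℝ) {ℓ n j : ℕ}
    (h : ¬ InDescendantRange ℓ n j) : hrNum Δ ℓ n j = 0 := by
  unfold hrNum
  rw [hrCoeff_eq_zero_of_not_inDescendantRange Δ h, zero_mul]

/-- The recursion for `Ã` on the descendant range at levels `n + 1 ≥ 2`: the pivot of `(n+1, j)`
cancels and the OTHER pivots of the level multiply in: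
`Ã_{n+1,j} = (γ⁺ Ã_{n,j-1} + γ⁻ Ã_{n,j+1}) · ∏_{i ≠ j} (C_{Δ+n+1,i} - C_{Δ,ℓ})`.
[cite: HogervorstRychkov2013, §3 eq. (3.9)] -/
theorem hrNum_succ {Δ : ℝ} {ℓ n j : ℕ} (hΔ : (ℓ : ℝ) + 1 ≤ Δ) (hn : 1 ≤ n)
    (hr : InDescendantRange ℓ (n + 1) j) :
    hrNum Δ ℓ (n + 1) j =
      ((if j = 0 then 0 else hrGammaPlus (Δ + n) (j - 1) * hrNum Δ ℓ n (j - 1)) +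
          hrGammaMinus (Δ + n) (j + 1) * hrNum Δ ℓ n (j + 1)) *
        ∏ i ∈ (descendantLevel ℓ (n + 1)).erase j, casimirPivot3D Δ ℓ (n + 1) i := by
  have hp : casimirPivot3D Δ ℓ (n + 1) j ≠ 0 :=
    (casimirPivot3D_pos_of_two_le hΔ (by omega) hr.1).ne'
  have hrec := hrCoeff_succ_rec hp
  have hmem : j ∈ descendantLevel ℓ (n + 1) := mem_descendantLevel.2 hr
  unfold hrNum
  rw [pivotProd_succ Δ ℓ hn, levelPivotProd, ← Finset.mul_prod_erase _ _ hmem]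
  split_ifs at hrec ⊢ with hj
  · calc hrCoeff Δ ℓ (n + 1) j * (pivotProd Δ ℓ n * (casimirPivot3D Δ ℓ (n + 1) j *
          ∏ i ∈ (descendantLevel ℓ (n + 1)).erase j, casimirPivot3D Δ ℓ (n + 1) i))
        = (casimirPivot3D Δ ℓ (n + 1) j * hrCoeff Δ ℓ (n + 1) j) * pivotProd Δ ℓ n *
          ∏ i ∈ (descendantLevel ℓ (n + 1)).erase j, casimirPivot3D Δ ℓ (n + 1) i := by ring
      _ = _ := by rw [hrec]; ring
  · calc hrCoeff Δ ℓ (n + 1) j * (pivotProd Δ ℓ n * (casimirPivot3D Δ ℓ (n + 1) j *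
          ∏ i ∈ (descendantLevel ℓ (n + 1)).erase j, casimirPivot3D Δ ℓ (n + 1) i))
        = (casimirPivot3D Δ ℓ (n + 1) j * hrCoeff Δ ℓ (n + 1) j) * pivotProd Δ ℓ n *
          ∏ i ∈ (descendantLevel ℓ (n + 1)).erase j, casimirPivot3D Δ ℓ (n + 1) i := by ring
      _ = _ := by rw [hrec]; ring

/-- **Monotonicity of the pivot-cleared coefficients.** For `ℓ + 1 ≤ Δ ≤ Δ'`:
`Ã_{n,j}(Δ) ≤ Ã_{n,j}(Δ')` for all `n, j`. Level `1` from the closed forms; then induction on the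
level with `hrNum_succ`: every factor is non-negative and non-decreasing (`γ⁻_{Δ+n,j+1}` because its
base `Δ + n - j - 2 ≥ Δ - ℓ - 1 ≥ 0` whenever `Ã_{n,j+1} ≠ 0`, i.e. `j + 1 ≤ ℓ + n`).
[cite: HogervorstRychkov2013, §3 eq. (3.9)] -/
theorem hrNum_mono {Δ Δ' : ℝ} {ℓ : ℕ} (hΔ : (ℓ : ℝ) + 1 ≤ Δ) (h : Δ ≤ Δ') :
    ∀ n j : ℕ, hrNum Δ ℓ n j ≤ hrNum Δ' ℓ n j := by
  have hΔ' : (ℓ : ℝ) + 1 ≤ Δ' := hΔ.trans h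
  have hℓ0 : (0 : ℝ) ≤ ℓ := Nat.cast_nonneg ℓ
  have hΔ0 : (0 : ℝ) ≤ Δ := by linarith
  -- levels `n ≥ 1` by induction from the level-one closed forms
  have hpos : ∀ n : ℕ, 1 ≤ n → ∀ j : ℕ, hrNum Δ ℓ n j ≤ hrNum Δ' ℓ n j := by
    intro n hn
    induction n, hn using Nat.le_induction with
    | base =>
      intro j
      unfold hrNum
      rw [pivotProd_one, pivotProd_one, mul_one, mul_one]
      exact hrCoeff_one_mono hΔ h j
    | succ n hn ih =>
      intro j
      by_cases hr : InDescendantRange ℓ (n + 1) j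
      · rw [hrNum_succ hΔ hn hr, hrNum_succ hΔ' hn hr]
        have hpiv0 : ∀ i ∈ (descendantLevel ℓ (n + 1)).erase j,
            0 ≤ casimirPivot3D Δ ℓ (n + 1) i := by
          intro i hi
          have hri := mem_descendantLevel.1 (Finset.mem_of_mem_erase hi)
          exact (casimirPivot3D_pos_of_two_le hΔ (by omega) hri.1).le
        have hE : (0 : ℝ) ≤ Δ + n := by positivity
        apply mul_le_mul
        · apply add_le_add
          · split_ifs with hj
            · exact le_rfl
            · exact mul_le_mul (hrGammaPlus_mono hE (by linarith) _) (ih (j - 1))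
                (hrNum_nonneg hΔ _ _) (hrGammaPlus_nonneg _ _)
          · by_cases hr1 : InDescendantRange ℓ n (j + 1)
            · have hjn : ((j + 1 : ℕ) : ℝ) + 1 ≤ Δ + n := by
                have h1 : j + 1 + 1 ≤ ℓ + 1 + n := by have := hr1.2.1; omega
                have h2 : ((j + 1 : ℕ) : ℝ) + 1 ≤ ((ℓ : ℝ) + 1) + n := by exact_mod_cast h1
                linarith
              exact mul_le_mul (hrGammaMinus_mono hjn (by linarith)) (ih (j + 1))
                (hrNum_nonneg hΔ _ _) (hrGammaMinus_nonneg _ _)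
            · rw [hrNum_eq_zero_of_not_inDescendantRange Δ hr1,
                hrNum_eq_zero_of_not_inDescendantRange Δ' hr1, mul_zero, mul_zero]
        · exact Finset.prod_le_prod hpiv0 (fun i _ => casimirPivot3D_mono h ℓ (n + 1) i)
        · exact Finset.prod_nonneg hpiv0
        · refine add_nonneg ?_ (mul_nonneg (hrGammaMinus_nonneg _ _) (hrNum_nonneg hΔ' _ _))
          split_ifs
          · exact le_rfl
          · exact mul_nonneg (hrGammaPlus_nonneg _ _) (hrNum_nonneg hΔ' _ _)
      · rw [hrNum_eq_zero_of_not_inDescendantRange Δ hr,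
          hrNum_eq_zero_of_not_inDescendantRange Δ' hr]
  intro n
  rcases Nat.eq_zero_or_pos n with h0 | hn
  · subst h0
    intro j
    unfold hrNum
    rw [pivotProd_zero, pivotProd_zero]
    by_cases hj : j = ℓ
    · subst hj; simp
    · rw [hrCoeff_zero_of_ne Δ hj, hrCoeff_zero_of_ne Δ' hj]
  · exact hpos n hn

/-! ### The cell bounds -/

/-- **Lower cell bound.** On `ℓ + 1 ≤ Δ₁ ≤ Δ ≤ Δ₂`:
`A_{n,j}(Δ₁) · P_n(Δ₁)/P_n(Δ₂) ≤ A_{n,j}(Δ)`. [cite: HogervorstRychkov2013, §3 eq. (3.9)] -/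
theorem hrCoeff_cell_lower {Δ₁ Δ Δ₂ : ℝ} {ℓ : ℕ} (hℓ : (ℓ : ℝ) + 1 ≤ Δ₁) (h1 : Δ₁ ≤ Δ)
    (h2 : Δ ≤ Δ₂) (n j : ℕ) :
    hrCoeff Δ₁ ℓ n j * (pivotProd Δ₁ ℓ n / pivotProd Δ₂ ℓ n) ≤ hrCoeff Δ ℓ n j := by
  have hΔ : (ℓ : ℝ) + 1 ≤ Δ := hℓ.trans h1
  have hP2 : 0 < pivotProd Δ₂ ℓ n := pivotProd_pos (hΔ.trans h2) n
  have hmono : hrCoeff Δ₁ ℓ n j * pivotProd Δ₁ ℓ n ≤ hrCoeff Δ ℓ n j * pivotProd Δ ℓ n :=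
    hrNum_mono hℓ h1 n j
  have hup : hrCoeff Δ ℓ n j * pivotProd Δ ℓ n ≤ hrCoeff Δ ℓ n j * pivotProd Δ₂ ℓ n :=
    mul_le_mul_of_nonneg_left (pivotProd_mono hΔ h2 n) (hrCoeff_nonneg_of_le hΔ n j)
  rw [← mul_div_assoc, div_le_iff₀ hP2]
  exact hmono.trans hup

/-- **Upper cell bound.** On `ℓ + 1 ≤ Δ₁ ≤ Δ ≤ Δ₂`:
`A_{n,j}(Δ) ≤ A_{n,j}(Δ₂) · P_n(Δ₂)/P_n(Δ₁)`. [cite: HogervorstRychkov2013, §3 eq. (3.9)] -/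
theorem hrCoeff_cell_upper {Δ₁ Δ Δ₂ : ℝ} {ℓ : ℕ} (hℓ : (ℓ : ℝ) + 1 ≤ Δ₁) (h1 : Δ₁ ≤ Δ)
    (h2 : Δ ≤ Δ₂) (n j : ℕ) :
    hrCoeff Δ ℓ n j ≤ hrCoeff Δ₂ ℓ n j * (pivotProd Δ₂ ℓ n / pivotProd Δ₁ ℓ n) := by
  have hΔ : (ℓ : ℝ) + 1 ≤ Δ := hℓ.trans h1
  have hP1 : 0 < pivotProd Δ₁ ℓ n := pivotProd_pos hℓ n
  have hmono : hrCoeff Δ ℓ n j * pivotProd Δ ℓ n ≤ hrCoeff Δ₂ ℓ n j * pivotProd Δ₂ ℓ n :=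
    hrNum_mono hΔ h2 n j
  have hlo : hrCoeff Δ ℓ n j * pivotProd Δ₁ ℓ n ≤ hrCoeff Δ ℓ n j * pivotProd Δ ℓ n :=
    mul_le_mul_of_nonneg_left (pivotProd_mono hℓ h1 n) (hrCoeff_nonneg_of_le hΔ n j)
  rw [← mul_div_assoc, le_div_iff₀ hP1]
  exact hlo.trans hmono

/-- The two bounds as membership in an interval whose ends are finite (rational, for rational
`Δ₁, Δ₂`) evaluations. [cite: HogervorstRychkov2013, §3 eq. (3.9)] -/
theorem hrCoeff_mem_Icc_cell {Δ₁ Δ Δ₂ : ℝ} {ℓ : ℕ} (hℓ : (ℓ : ℝ) + 1 ≤ Δ₁) (h1 : Δ₁ ≤ Δ)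
    (h2 : Δ ≤ Δ₂) (n j : ℕ) :
    hrCoeff Δ ℓ n j ∈ Set.Icc (hrCoeff Δ₁ ℓ n j * (pivotProd Δ₁ ℓ n / pivotProd Δ₂ ℓ n))
      (hrCoeff Δ₂ ℓ n j * (pivotProd Δ₂ ℓ n / pivotProd Δ₁ ℓ n)) :=
  ⟨hrCoeff_cell_lower hℓ h1 h2 n j, hrCoeff_cell_upper hℓ h1 h2 n j⟩

end Literature.MathematicalPhysics.QuantumFieldTheory.ConformalBootstrap3D
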